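import Mathlib
import HarnessLib
import Summits.ResolutionOfSingularities.ResolutionOfSingularities.Theorems.WildQuotientsWildQuotientResolutionKSBlowupEquivariantChartOfHyperplane
import Summits.ResolutionOfSingularities.ResolutionOfSingularities.Theorems.WildQuotientsWildQuotientResolutionKSBlowupFixedPointDim

/-!
# Kollár–Szabó going down for WILD inertia: the point blow-up at a closed regular point fixed by a finite
# `p`-group has a closed regular fixed point with the same (full) inertia
# (crux `WildQuotients.WildQuotientResolution`, stub `stub_phaseZeroHighDim`)

Crux stmt-ResolutionOfSingularities-15640 (`WildQuotientResolution`), registered stub `stub_phaseZeroHighDim`;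
programme PHASE0-KS-EIGENLINE, wild extension of hand 8-g2's chain (✓`exists_fixedPoint_liftAction_step`, p829367,
abelian stabilisers). Replacing the abelian eigenline by the wild one (✓`PGroupEigenline`,
✓`exists_equivariant_quadraticTransform_of_isPGroup`) the whole scheme-level chain runs verbatim:

* `exists_fixedPoint_liftAction_of_isPGroup` — for an integral `X`, a finite `p`-GROUP `G` with `g ∈ I_x` for all `g`
  at a closed point `x` with `𝒪_{X,x}` regular, not a field, and `char κ(x) = p`, and ANY blowing up `π : X' → X` of
  the reduced point `{x}` with its LIFTED action: a point `x' ∈ X'` over `x` with `g ∈ I_{x'}` for every `g`, plus its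
  quadratic-transform chart;
* `exists_fixedPoint_liftAction_step_of_isPGroup` — **the wild step reproduces all its hypotheses**: `X'` integral and
  locally Noetherian, `x'` CLOSED, in the inertia of every `g`, `𝒪_{X',x'}` regular, not a field, of the same
  dimension, and `κ(x') ≅ κ(x)` (so again of characteristic `p`). In words: **point blow-ups at fixed points never
  shrink a wild (p-group) inertia group** — the tower of Kollár–Szabó fixed points exists for wild stabilisers, in
  every dimension (a constraint on any Phase-0 strategy by point blow-ups for the crux).

[OURS · crux stmt-ResolutionOfSingularities-15640 · helper toward `stub_phaseZeroHighDim` (wild Kollár–Szabó fixed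
point; NOT a proof of the stub); counted 0; AI-level work, weaker than expert review.]
[cite: ReichsteinYoussin2000, Appendix (Kollár–Szabó), Lemma A.1 and Prop. A.2]
-/

-- single-problem summit: the doubled namespace component `ResolutionOfSingularities` is forced
set_option linter.dupNamespace false

noncomputable section

open CategoryTheory CategoryTheory.Limits AlgebraicGeometry TopologicalSpace IsLocalRing
open Literature.AlgebraicGeometry.Ramification Literature.AlgebraicGeometry.Resolution
open Scheme.IdealSheafData
open Summit.ResolutionOfSingularities.ResolutionOfSingularities.Theorems.WildQuotientResolution

namespace Summit.ResolutionOfSingularities.ResolutionOfSingularities.Theorems.WildQuotientResolution.KSGoingDown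

/-- **The wild fixed point of the point blow-up (Kollár–Szabó going down for a `p`-group).** Let `X` be an
integral scheme, `G` a finite `p`-group acting on `X` with `g ∈ I_x` for all `g` at a closed point `x` whose local
ring is regular, not a field, with residue field of characteristic `p`, and `π : X' → X` a blowing up along the
reduced closed point `{x}`, with the lifted action. Then there are a quadratic-transform chart
`(R ⊆ Frac 𝒪_{X,x}, ι, t, φ : Spec R → X')` and the point `x' = φ(closed point)` over `x` such that every `g` lies
in the inertia group of the lifted action at `x'`. [cite: ReichsteinYoussin2000, Appendix, Lemma A.1, Prop. A.2] -/
theorem exists_fixedPoint_liftAction_of_isPGroup {X : Scheme.{0}} [IsIntegral X] {G : Type} [Group G] [Finite G]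
    {p : ℕ} [Fact p.Prime] (hG : IsPGroup p G)
    (σ : G →* Aut X) {x : X} (hx : IsClosed ({x} : Set X)) (hGx : ∀ g, g ∈ inertiaSubgroup σ x)
    [IsRegularLocalRing (X.presheaf.stalk x)] [CharP (ResidueField (X.presheaf.stalk x)) p]
    (hnf : ¬ IsField (X.presheaf.stalk x))
    {X' : Scheme.{0}} {π : X' ⟶ X} (hπ : IsBlowup π (vanishingIdeal ⟨{x}, hx⟩)) :
    ∃ (R : Subring (FractionRing (X.presheaf.stalk x))) (_ : IsLocalRing R)
      (ι : X.presheaf.stalk x →+* R) (_ : IsLocalHom ι) (t : R) (φ : Spec (.of R) ⟶ X') (x' : X'),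
      IsQuadraticTransform (algebraMap (X.presheaf.stalk x) (FractionRing (X.presheaf.stalk x))).range R ∧
      (∀ a, ((ι a : R) : FractionRing (X.presheaf.stalk x)) =
        algebraMap (X.presheaf.stalk x) (FractionRing (X.presheaf.stalk x)) a) ∧
      Function.Injective ι ∧ t ≠ 0 ∧ (maximalIdeal (X.presheaf.stalk x)).map ι = Ideal.span {t} ∧
      (∀ r : R, ∃ a, ι a - r ∈ maximalIdeal R) ∧
      φ ≫ π = Spec.map (CommRingCat.ofHom ι) ≫ X.fromSpecStalk x ∧ φ (closedPoint R) = x' ∧ π x' = x ∧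
      ∀ g, g ∈ inertiaSubgroup (hπ.liftAction σ (vanishingIdeal_comap_eq_of_action σ ⟨{x}, hx⟩
        (preimage_singleton_eq_of_forall_mem_inertiaSubgroup σ hGx))) x' := by
  -- the stalk action of `G = I_x` and its residue-triviality
  obtain ⟨a, τ, hkey, hτ⟩ := PointBlowupStalkData.exists_stalkAction σ x (⊤ : Subgroup G)
    (fun g _ => apply_eq_of_mem_inertiaSubgroup σ (hGx g))
  have htop : (⊤ : Subgroup G) ≤ inertiaSubgroup σ x := fun g _ => hGx g
  have hresO : ∀ (g : (⊤ : Subgroup G)) (s : X.presheaf.stalk x), τ g s - s ∈ maximalIdeal _ :=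
    InertLocusStalk.stalkAction_residueTrivial σ x a τ hkey hτ htop
  -- the wild equivariant quadratic transform
  obtain ⟨R, hRloc, ι, hιloc, t, α, hQT, hι, hιinj, ht0, hmap, hα, hres, hcong⟩ :=
    exists_equivariant_quadraticTransform_of_isPGroup hnf (hG.to_subgroup ⊤) τ hresO
  -- repackage over `G`
  let a' : G → (X.presheaf.stalk x ⟶ X.presheaf.stalk x) := fun g => a ⟨g, Subgroup.mem_top g⟩
  have hkey' : ∀ g, Spec.map (a' g) ≫ X.fromSpecStalk x = X.fromSpecStalk x ≫ (σ g).hom := fun g =>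
    hkey ⟨g, Subgroup.mem_top g⟩
  let α' : G → (R →+* R) := fun g => α ⟨g⁻¹, Subgroup.mem_top _⟩
  have hα' : ∀ g, (α' g).comp ι = ι.comp (a' g).hom := by
    intro g
    have hinv : (⟨g⁻¹, Subgroup.mem_top _⟩ : (⊤ : Subgroup G))⁻¹ = ⟨g, Subgroup.mem_top g⟩ :=
      Subtype.ext (inv_inv g)
    refine (hα ⟨g⁻¹, Subgroup.mem_top _⟩).trans ?_
    ext s
    change ((ι (τ ⟨g⁻¹, Subgroup.mem_top _⟩ s) : R) : FractionRing (X.presheaf.stalk x)) =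
      ((ι ((a ⟨g, Subgroup.mem_top g⟩).hom s) : R) : FractionRing (X.presheaf.stalk x))
    rw [hτ, hinv]
  have hres' : ∀ (g : G) (r : R), α' g r - r ∈ maximalIdeal R := fun g r => hres _ r
  have htnz : t ∈ nonZeroDivisors R := mem_nonZeroDivisors_of_ne_zero ht0
  obtain ⟨φ, x', hφ, hφx', hx'x, hinert⟩ :=
    exists_fixedPoint_liftAction_of_localChart hx hπ σ
      (preimage_singleton_eq_of_forall_mem_inertiaSubgroup σ hGx) a' hkey' ι htnz hmap α' hα' hres'
  exact ⟨R, hRloc, ι, hιloc, t, φ, x', hQT, hι, hιinj, ht0, hmap, hcong, hφ, hφx', hx'x, hinert⟩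

/-- **The wild Kollár–Szabó step reproduces all its hypotheses.** For an integral locally Noetherian `X`, a
finite `p`-group `G` with `g ∈ I_x` for all `g` at a closed point `x` with `𝒪_{X,x}` regular, not a field,
`char κ(x) = p`, and a blowing up `π : X' → X` of the reduced point `{x}` with its LIFTED action: `X'` is integral
and locally Noetherian, and there is a CLOSED point `x' ∈ X'` over `x`, in the inertia group of every `g`, with
`𝒪_{X',x'}` regular, not a field, of the same dimension as `𝒪_{X,x}`, and `κ(x') ≅ κ(x)`. Point blow-ups at fixed
points never shrink wild inertia. [cite: ReichsteinYoussin2000, Appendix (Kollár–Szabó), Lemma A.1, Prop. A.2] -/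
theorem exists_fixedPoint_liftAction_step_of_isPGroup {X : Scheme.{0}} [IsIntegral X] [IsLocallyNoetherian X]
    {G : Type} [Group G] [Finite G] {p : ℕ} [Fact p.Prime] (hG : IsPGroup p G)
    (σ : G →* Aut X) {x : X} (hx : IsClosed ({x} : Set X)) (hGx : ∀ g, g ∈ inertiaSubgroup σ x)
    [IsRegularLocalRing (X.presheaf.stalk x)] [CharP (ResidueField (X.presheaf.stalk x)) p]
    (hnf : ¬ IsField (X.presheaf.stalk x))
    {X' : Scheme.{0}} {π : X' ⟶ X} (hπ : IsBlowup π (vanishingIdeal ⟨{x}, hx⟩)) :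
    IsIntegral X' ∧ IsLocallyNoetherian X' ∧
    ∃ x' : X', π x' = x ∧ IsClosed ({x'} : Set X') ∧
      (∀ g, g ∈ inertiaSubgroup (hπ.liftAction σ (vanishingIdeal_comap_eq_of_action σ ⟨{x}, hx⟩
        (preimage_singleton_eq_of_forall_mem_inertiaSubgroup σ hGx))) x') ∧
      IsRegularLocalRing (X'.presheaf.stalk x') ∧ ¬ IsField (X'.presheaf.stalk x') ∧
      ringKrullDim (X'.presheaf.stalk x') = ringKrullDim (X.presheaf.stalk x) ∧
      Nonempty (ResidueField (X'.presheaf.stalk x') ≃+* ResidueField (X.presheaf.stalk x)) := by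
  haveI hint : IsIntegral X' :=
    hπ.isIntegral (vanishingIdeal_singleton_ne_bot hx (genericPoint_ne_of_not_isField hnf))
  haveI : IsLocallyNoetherian X' := hπ.isLocallyNoetherian
  obtain ⟨R, hRloc, ι, hιloc, t, φ, x', hQT, hι, -, -, -, hcong, hφ, hφx', hx'x, hinert⟩ :=
    exists_fixedPoint_liftAction_of_isPGroup hG σ hx hGx hnf hπ
  haveI := hRloc
  haveI := hιloc
  -- the model `S` of `𝒪_{X,x}` in its fraction field is a regular local ring
  let O := X.presheaf.stalk x
  let f : O →+* FractionRing O := algebraMap O (FractionRing O)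
  have hf : Function.Injective f := IsFractionRing.injective O (FractionRing O)
  have hrr : Function.Injective f.rangeRestrict := fun a b h => hf (congrArg Subtype.val h)
  let e : O ≃+* f.range := RingEquiv.ofBijective f.rangeRestrict ⟨hrr, RingHom.rangeRestrict_surjective f⟩
  haveI : IsRegularLocalRing f.range := IsRegularLocalRing.of_ringEquiv e
  haveI : IsRegularLocalRing R := isRegularLocalRing_of_isQuadraticTransform _ R hQT
  obtain ⟨eR⟩ := nonempty_stalk_ringEquiv_of_isQuadraticTransform hx hπ R hQT ι hι φ hφ hφx'
  -- same residue field
  have hsurj : ∀ z : R, ∃ s : O, z - ι s ∈ maximalIdeal R := fun z => by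
    obtain ⟨a, ha⟩ := hcong z
    exact ⟨a, by rw [← neg_sub]; exact neg_mem ha⟩
  have hres : ∀ r : R, ∃ s : f.range, r - Subring.inclusion hQT.dominates.1 s ∈ maximalIdeal R := by
    intro r
    obtain ⟨a, ha⟩ := hsurj r
    refine ⟨e a, ?_⟩
    have : Subring.inclusion hQT.dominates.1 (e a) = ι a := Subtype.ext (by rw [hι]; rfl)
    rwa [this]
  let eκ : ResidueField O ≃+* ResidueField R :=
    RingEquiv.ofBijective (ResidueField.map ι) (bijective_residueField_map_of_residue_surjective ι hsurj)
  -- dimension and closedness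
  have hdimR : ringKrullDim R = ringKrullDim (X.presheaf.stalk x) := by
    rw [ringKrullDim_eq_of_isQuadraticTransform_of_residue _ R hQT hres]
    exact ringKrullDim_eq_of_ringEquiv e.symm
  have hdim : ringKrullDim (X'.presheaf.stalk x') = ringKrullDim (X.presheaf.stalk x) := by
    rw [ringKrullDim_eq_of_ringEquiv eR, hdimR]
  have hclosed : IsClosed ({x'} : Set X') := by
    refine hπ.isClosed_singleton_of_ringKrullDim_eq (x' := x') (by rw [hx'x]; exact hx) ?_
    rw [hdim, hx'x]
  haveI hreg' : IsRegularLocalRing (X'.presheaf.stalk x') := IsRegularLocalRing.of_ringEquiv eR.symm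
  exact ⟨hint, inferInstance, x', hx'x, hclosed, hinert, hreg', not_isField_of_ringKrullDim_eq hdim hnf, hdim,
    ⟨(ResidueField.mapEquiv eR).trans eκ.symm⟩⟩

end Summit.ResolutionOfSingularities.ResolutionOfSingularities.Theorems.WildQuotientResolution.KSGoingDown

end
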